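import Mathlib.Analysis.Complex.RealDeriv
import Summits.KontsevichZagierPeriods.KontsevichZagierPeriods.Theorems.SoloInformedNashSymbol
import Summits.KontsevichZagierPeriods.KontsevichZagierPeriods.Theorems.SoloInformedArcSmooth
import Summits.KontsevichZagierPeriods.KontsevichZagierPeriods.Theorems.SoloInformedEtaleSymbol
import Literature.NumberTheory.Transcendental.KZSemiCanonicalReductionProofs
import Literature.NumberTheory.Transcendental.KZDilationMove
import Literature.NumberTheory.Transcendental.KZTameMoveFamily
import Literature.NumberTheory.Transcendental.KZLogCalculusProofs
import Literature.NumberTheory.Transcendental.KZRulesAssociator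

/-!
# Good pieces of a semialgebraic arc are `κ̃` of Nash symbols (Rung 2, file E3)

Solo programme `solo-KontsevichZagierPeriods-informed`, step L4 of `paper/rung2-v2.md`.

Let `ρ = [(a, b), g]` be a one-variable Kontsevich–Zagier representation with continuous
`ℚ`-semialgebraic integrand `g`, `p ∈ ℚ[x][y]` a relation (`p(t, g t) = 0` on `(a, b)`, file E1),
and `[u, v] ⊂ (a, b)` a compact piece with rational ends all of whose points are *good*
(`∂_y p(t, g t) ≠ 0`). Then `g` is `C¹` near `[u, v]` (file E2) and the Huber–Wüstholz symbol
`σ = (Z_p, y ds, γ)` on the étale graph curve `Z_p ⊂ ℂ³` (files E3a/E3b) with the Nash path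
`γ(t) = (φ t, g (φ t), 1/∂_y p(φ t, g(φ t)))`, `φ t = u + (v − u) t`, satisfies

`κ̃(σ) = (⟦[(u, v), g]⟧, 0) ∈ V`

(`SoloInformedGoodPiece.kappaTilde_eq`): the period integrand is `(v − u) · g(φ t)` (real), which is
`[(u, v), g]` after a rational translation and dilation move and discarding the null end points.
[Huber–Wüstholz 2022, §13.1; Kontsevich–Zagier 2001, §1.2]
-/

noncomputable section

open Set Filter Topology MeasureTheory
open scoped Polynomial
open Literature.NumberTheory.Transcendental Literature.NumberTheory.Transcendental.KZ
open Literature.NumberTheory.Transcendental.CurvePeriods Literature.ModelTheory.ExponentialFields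

namespace Summit.KontsevichZagierPeriods.KontsevichZagierPeriods.Theorems

/-! ## 1. `ℚ ⊂ ℂ` versus `ℚ ⊂ ℝ` evaluation, margins -/

/-- Over `K = ℚ`, complex evaluation at real points is real evaluation (as ring homomorphisms). -/
theorem soloInformed_evCHom_rat (x y : ℝ) :
    soloInformedEvCHom (K := ℚ) (x : ℂ) (y : ℂ) = Complex.ofRealHom.comp (soloInformedEvR x y) := by
  refine Polynomial.ringHom_ext' (Polynomial.ringHom_ext' (Subsingleton.elim _ _) ?_) ?_
  · simp only [RingHom.comp_apply, soloInformedEvCHom_apply, Complex.ofRealHom_eq_coe,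
      soloInformedEvR_C, Polynomial.map_X, Polynomial.eval_X]
    simp [soloInformedEvC]
  · simp only [RingHom.comp_apply, soloInformedEvCHom_apply, Complex.ofRealHom_eq_coe,
      soloInformedEvR_X]
    simp [soloInformedEvC]

/-- Over `K = ℚ`: `p(x, y)` computed in `ℂ` at real `x, y` is the real number `evR x y p`. -/
theorem soloInformed_evC_ofReal (p : ℚ[X][X]) (x y : ℝ) :
    soloInformedEvC p (x : ℂ) (y : ℂ) = ((soloInformedEvR x y p : ℝ) : ℂ) := by
  rw [← soloInformedEvCHom_apply, soloInformed_evCHom_rat]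
  rfl

/-- `Y(s, Y) = Y`. -/
theorem soloInformed_evC_X {K : Type*} [Field K] [Algebra K ℂ] (s W : ℂ) :
    soloInformedEvC (K := K) Polynomial.X s W = W := by
  simp [soloInformedEvC]

/-- An open set containing `[0, 1]` contains `(−ε, 1 + ε)` for some rational `ε > 0`. -/
theorem soloInformed_exists_rat_margin {U : Set ℝ} (hU : IsOpen U) (h : Icc (0 : ℝ) 1 ⊆ U) :
    ∃ ε : ℚ, 0 < ε ∧ Ioo (-(ε : ℝ)) (1 + ε) ⊆ U := by
  obtain ⟨δ₀, hδ₀, h₀⟩ := Metric.isOpen_iff.1 hU 0 (h ⟨le_rfl, zero_le_one⟩)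
  obtain ⟨δ₁, hδ₁, h₁⟩ := Metric.isOpen_iff.1 hU 1 (h ⟨zero_le_one, le_rfl⟩)
  obtain ⟨ε, hε0, hε⟩ := exists_rat_btwn (lt_min hδ₀ hδ₁)
  refine ⟨ε, by exact_mod_cast hε0, fun t ht => ?_⟩
  rcases lt_or_ge t 0 with ht0 | ht0
  · refine h₀ ?_
    rw [Metric.mem_ball, Real.dist_eq, sub_zero, abs_of_neg ht0]
    linarith [ht.1, min_le_left δ₀ δ₁]
  rcases le_or_gt t 1 with ht1 | ht1
  · exact h ⟨ht0, ht1⟩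
  · refine h₁ ?_
    rw [Metric.mem_ball, Real.dist_eq, abs_of_pos (by linarith)]
    linarith [ht.2, min_le_right δ₀ δ₁]

/-- Functions with semialgebraic real values have semialgebraic real and imaginary parts. -/
theorem soloInformed_reImSA_ofReal {m : ℕ} {S : Set (Fin m → ℝ)} (hS : IsSemialgebraic ℚ S)
    {f : (Fin m → ℝ) → ℝ} (hf : IsSemialgebraicFunOn ℚ S f) :
    IsSemialgebraicFunOn ℚ S (fun x => (((f x : ℝ) : ℂ)).re) ∧
      IsSemialgebraicFunOn ℚ S (fun x => (((f x : ℝ) : ℂ)).im) :=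
  ⟨hf.congr fun x _ => (Complex.ofReal_re (f x)).symm,
    (isSemialgebraicFunOn_aeval hS (0 : MvPolynomial (Fin m) ℚ)).congr fun x _ => by simp⟩

/-- The integrand of a one-variable representation, read as a function on `ℝ`. -/
def soloInformedArcFun (ρ : IntegralRep 1) (t : ℝ) : ℝ := ρ.integrand fun _ => t

/-- `ρ.integrand x = g (x 0)`. -/
theorem soloInformed_integrand_eq_arcFun (ρ : IntegralRep 1) (x : Fin 1 → ℝ) :
    ρ.integrand x = soloInformedArcFun ρ (x 0) := by
  unfold soloInformedArcFun
  congr 1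
  funext i
  rw [Subsingleton.elim i 0]

/-! ## 2. Good pieces -/

/-- **A good piece** of a semialgebraic arc: `ρ = [(a, b), g]` with `g` continuous, a relation
`p(t, g t) = 0` on `(a, b)`, and a compact piece `[u, v] ⊂ (a, b)` with rational ends on which
`∂_y p(t, g t) ≠ 0`. -/
structure SoloInformedGoodPiece where
  /-- The arc representation. -/
  ρ : IntegralRep 1
  /-- Left end of the arc. -/
  a : ℝ
  /-- Right end of the arc. -/
  b : ℝ
  /-- The domain is the open interval `(a, b)`. -/
  dom : ρ.domain = soloInformedIoo1 a b
  /-- The integrand is continuous. -/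
  cont : ContinuousOn ρ.integrand ρ.domain
  /-- The relation. -/
  p : ℚ[X][X]
  /-- `p(t, g t) = 0` on `(a, b)`. -/
  rel : ∀ t ∈ Ioo a b, soloInformedEvR t (soloInformedArcFun ρ t) p = 0
  /-- Left end of the piece. -/
  u : ℚ
  /-- Right end of the piece. -/
  v : ℚ
  /-- The piece is non-degenerate. -/
  lt : u < v
  /-- The piece lies in the arc. -/
  sub : Icc (u : ℝ) v ⊆ Ioo a b
  /-- All points of the piece are good. -/
  good : ∀ t ∈ Icc (u : ℝ) v,
    soloInformedEvR t (soloInformedArcFun ρ t) (Polynomial.derivative p) ≠ 0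

namespace SoloInformedGoodPiece

variable (P : SoloInformedGoodPiece)

/-- The integrand `g`. -/
def g : ℝ → ℝ := soloInformedArcFun P.ρ

/-- The affine parametrisation `φ t = u + (v − u) t` of `[u, v]` by `[0, 1]`. -/
def φ (t : ℝ) : ℝ := P.u + (P.v - P.u) * t

/-- `φ` is smooth. -/
theorem φ_contDiff {n : WithTop ℕ∞} : ContDiff ℝ n P.φ :=
  contDiff_const.add (contDiff_const.mul contDiff_id)

/-- `φ′ = v − u`, complexified. -/
theorem hasDerivAt_φ (t : ℝ) :
    HasDerivAt (fun t => ((P.φ t : ℝ) : ℂ)) (((P.v : ℝ) - P.u : ℝ) : ℂ) t := by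
  have h : HasDerivAt P.φ (((P.v : ℝ) - P.u) * 1) t :=
    ((hasDerivAt_id t).const_mul _).const_add _
  rw [mul_one] at h
  exact h.ofReal_comp

/-- `(u : ℝ) < v`. -/
theorem lt_real : (P.u : ℝ) < P.v := by exact_mod_cast P.lt

/-- `φ [0, 1] ⊆ [u, v]`. -/
theorem φ_mem_Icc {t : ℝ} (ht : t ∈ Icc (0 : ℝ) 1) : P.φ t ∈ Icc (P.u : ℝ) P.v := by
  have h := P.lt_real
  refine ⟨?_, ?_⟩
  · show (P.u : ℝ) ≤ P.u + (P.v - P.u) * t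
    nlinarith [ht.1]
  · show P.u + (P.v - P.u) * t ≤ (P.v : ℝ)
    nlinarith [ht.2]

/-- `g` is continuous on `(a, b)`. -/
theorem continuousOn_g : ContinuousOn P.g (Ioo P.a P.b) := by
  have hc : Continuous fun t : ℝ => (fun _ : Fin 1 => t) := continuous_pi fun _ => continuous_id
  refine (P.cont.comp hc.continuousOn fun t ht => ?_)
  rw [P.dom]
  exact ht

/-- A good open neighbourhood of `[u, v]` on which `g` is `C¹` (file E2). -/
theorem exists_goodNhds : ∃ U : Set ℝ, IsOpen U ∧ Icc (P.u : ℝ) P.v ⊆ U ∧ U ⊆ Ioo P.a P.b ∧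
    ContDiffOn ℝ 1 P.g U ∧
      ∀ t ∈ U, soloInformedEvR t (P.g t) (Polynomial.derivative P.p) ≠ 0 :=
  soloInformed_contDiffOn_nhds_of_good isOpen_Ioo P.continuousOn_g P.rel P.sub P.good one_ne_zero

/-- The good neighbourhood. -/
def U : Set ℝ := P.exists_goodNhds.choose

/-- `U` is open. -/
theorem U_open : IsOpen P.U := P.exists_goodNhds.choose_spec.1

/-- `[u, v] ⊆ U`. -/
theorem Icc_subset_U : Icc (P.u : ℝ) P.v ⊆ P.U := P.exists_goodNhds.choose_spec.2.1

/-- `U ⊆ (a, b)`. -/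
theorem U_subset : P.U ⊆ Ioo P.a P.b := P.exists_goodNhds.choose_spec.2.2.1

/-- `g` is `C¹` on `U`. -/
theorem contDiffOn_g : ContDiffOn ℝ 1 P.g P.U := P.exists_goodNhds.choose_spec.2.2.2.1

/-- All points of `U` are good. -/
theorem good_U {t : ℝ} (ht : t ∈ P.U) :
    soloInformedEvR t (P.g t) (Polynomial.derivative P.p) ≠ 0 :=
  P.exists_goodNhds.choose_spec.2.2.2.2 t ht

/-- A rational margin: `φ (−ε, 1 + ε) ⊆ U`. -/
theorem exists_margin : ∃ ε : ℚ, 0 < ε ∧ Ioo (-(ε : ℝ)) (1 + ε) ⊆ P.φ ⁻¹' P.U :=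
  soloInformed_exists_rat_margin (P.U_open.preimage (P.φ_contDiff (n := 1)).continuous)
    fun _ ht => P.Icc_subset_U (P.φ_mem_Icc ht)

/-- The margin. -/
def ε : ℚ := P.exists_margin.choose

/-- The margin is positive. -/
theorem ε_pos : 0 < P.ε := P.exists_margin.choose_spec.1

/-- `φ t ∈ U` for `t ∈ (−ε, 1 + ε)`. -/
theorem φ_mem_U {t : ℝ} (ht : t ∈ Ioo (-(P.ε : ℝ)) (1 + P.ε)) : P.φ t ∈ P.U :=
  P.exists_margin.choose_spec.2 ht

/-- `φ t ∈ (a, b)` for `t ∈ (−ε, 1 + ε)`. -/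
theorem φ_mem_Ioo {t : ℝ} (ht : t ∈ Ioo (-(P.ε : ℝ)) (1 + P.ε)) : P.φ t ∈ Ioo P.a P.b :=
  P.U_subset (P.φ_mem_U ht)

/-- `g u`, `g v` (indeed `g` at algebraic good points) are algebraic. -/
theorem isAlgebraic_g {t : ℝ} (ht : IsAlgebraic ℚ t) (htI : t ∈ Icc (P.u : ℝ) P.v) :
    IsAlgebraic ℚ (P.g t) :=
  soloInformed_isAlgebraic_of_good ht (P.rel t (P.sub htI)) (P.good t htI)

/-- **The étale graph datum of a good piece**: `G = p`, `H = y`, `s = φ`, `Y = g ∘ φ`. -/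
def datum : SoloInformedEtaleDatum ℚ where
  G := P.p
  H := Polynomial.X
  s t := ((P.φ t : ℝ) : ℂ)
  Y t := ((P.g (P.φ t) : ℝ) : ℂ)
  ε := P.ε
  ε_pos := P.ε_pos
  s_contDiff := (Complex.ofRealCLM.contDiff.comp P.φ_contDiff).contDiffOn
  Y_contDiff := Complex.ofRealCLM.contDiff.comp_contDiffOn
    (P.contDiffOn_g.comp P.φ_contDiff.contDiffOn fun _ ht => P.φ_mem_U ht)
  root t ht := by
    rw [soloInformed_evC_ofReal, Complex.ofReal_eq_zero]
    exact P.rel _ (P.φ_mem_Ioo ht)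
  etale t ht := by
    rw [soloInformed_evC_ofReal, Ne, Complex.ofReal_eq_zero]
    exact P.good_U (P.φ_mem_U ht)
  s_zero := by
    have h : P.φ 0 = P.u := by simp [φ]
    have hR (x : ℝ) (hx : IsAlgebraic ℚ x) : IsAlgebraic ℚ (x : ℂ) := by
      simpa using hx.algebraMap (A := ℂ)
    rw [h]; exact hR _ (isAlgebraic_rat ℚ P.u)
  Y_zero := by
    have h : P.φ 0 = P.u := by simp [φ]
    have hR (x : ℝ) (hx : IsAlgebraic ℚ x) : IsAlgebraic ℚ (x : ℂ) := by
      simpa using hx.algebraMap (A := ℂ)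
    rw [h]; exact hR _ (P.isAlgebraic_g (isAlgebraic_rat ℚ P.u) ⟨le_rfl, P.lt_real.le⟩)
  s_one := by
    have h : P.φ 1 = P.v := by simp [φ]
    have hR (x : ℝ) (hx : IsAlgebraic ℚ x) : IsAlgebraic ℚ (x : ℂ) := by
      simpa using hx.algebraMap (A := ℂ)
    rw [h]; exact hR _ (isAlgebraic_rat ℚ P.v)
  Y_one := by
    have h : P.φ 1 = P.v := by simp [φ]
    have hR (x : ℝ) (hx : IsAlgebraic ℚ x) : IsAlgebraic ℚ (x : ℂ) := by
      simpa using hx.algebraMap (A := ℂ)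
    rw [h]; exact hR _ (P.isAlgebraic_g (isAlgebraic_rat ℚ P.v) ⟨P.lt_real.le, le_rfl⟩)

/-- `ℚ ⊂ ℂ` consists of algebraic numbers. -/
theorem hK : ∀ q : ℚ, IsAlgebraic ℚ (algebraMap ℚ ℂ q) := fun _ => isAlgebraic_algebraMap _

/-- **The symbol of a good piece.** -/
abbrev symbol : PeriodSymbol := P.datum.symbol hK

/-- The parameter set `(−ε, 1 + ε) ⊆ ℝ¹` is semialgebraic. -/
theorem isSemialgebraic_S : IsSemialgebraic ℚ (soloInformedIoo1 (-(P.ε : ℝ)) (1 + P.ε)) := by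
  have h := isSemialgebraic_soloInformedIoo1 (-P.ε) (1 + P.ε)
  push_cast at h
  exact h

/-- `x ↦ g (φ (x 0))` is `ℚ`-semialgebraic on `(−ε, 1 + ε) ⊆ ℝ¹` (pull-back of `g` along the
rational polynomial map `φ`). -/
theorem isSemialgebraicFunOn_g_φ :
    IsSemialgebraicFunOn ℚ (soloInformedIoo1 (-(P.ε : ℝ)) (1 + P.ε))
      (fun x => P.g (P.φ (x 0))) := by
  have h := IsSemialgebraicFunOn.comp_aeval P.ρ.isSemialgebraicFunOn_integrand
    (fun _ : Fin 1 => (MvPolynomial.C P.u + MvPolynomial.C (P.v - P.u) * MvPolynomial.X 0 :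
      MvPolynomial (Fin 1) ℚ))
  have hφ : ∀ x : Fin 1 → ℝ, (fun _ : Fin 1 => MvPolynomial.aeval x
      (MvPolynomial.C P.u + MvPolynomial.C (P.v - P.u) * MvPolynomial.X 0 :
        MvPolynomial (Fin 1) ℚ)) = fun _ => P.φ (x 0) := by
    intro x
    funext
    simp [φ]
  refine (h.mono (fun x hx => ?_) P.isSemialgebraic_S).congr fun x _ => ?_
  · rw [mem_preimage, hφ, P.dom]
    exact P.φ_mem_Ioo hx
  · show P.ρ.integrand _ = P.g (P.φ (x 0))
    rw [hφ]
    rfl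

/-- **The path of a good piece is a Nash path.** -/
theorem nash : SoloInformedIsNashPath P.symbol.γ.toFun := by
  refine ⟨P.ε, P.ε_pos, P.datum.contDiffOn_path, fun i => ?_⟩
  have hS := P.isSemialgebraic_S
  have hs := soloInformed_reImSA_ofReal hS
    ((isSemialgebraicFunOn_aeval hS (MvPolynomial.C P.u + MvPolynomial.C (P.v - P.u) *
      MvPolynomial.X 0 : MvPolynomial (Fin 1) ℚ)).congr fun x _ =>
        (show _ = P.φ (x 0) by simp [φ]))
  exact P.datum.re_im_path hK hS (fun _ hx => hx) hs
    (soloInformed_reImSA_ofReal hS P.isSemialgebraicFunOn_g_φ) i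

/-- **The period integrand of a good piece**: `y(γ) · s′ = (v − u) · g(φ t)`. -/
theorem pathIntegrand_eq (t : ℝ) :
    soloInformedPathIntegrand P.symbol t = ((((P.v : ℝ) - P.u) * P.g (P.φ t) : ℝ) : ℂ) := by
  unfold soloInformedPathIntegrand
  rw [P.datum.symbol_integrand hK]
  show soloInformedEvC (Polynomial.X : ℚ[X][X]) _ ((P.g (P.φ t) : ℝ) : ℂ) *
    deriv (fun t => ((P.φ t : ℝ) : ℂ)) t = _
  rw [soloInformed_evC_X]
  rw [(P.hasDerivAt_φ t).deriv]
  push_cast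
  ring

/-! ## 3. `κ̃` of a good piece -/

/-- The restricted representation `[(u, v), g]`. -/
def piece (hI : soloInformedIoo1 (P.u : ℝ) P.v ⊆ P.ρ.domain) : IntegralRep 1 :=
  P.ρ.restrict _ (isSemialgebraic_soloInformedIoo1 P.u P.v) hI

/-- `{0 ≤ t ≤ 1} ∖ {0 < t < 1}` is null in `ℝ¹`. -/
theorem volume_unitI_diff :
    volume (soloInformedUnitI \ soloInformedIoo1 ((0 : ℚ) : ℝ) ((1 : ℚ) : ℝ)) = 0 := by
  have h0 : volume {z : Fin 1 → ℝ | z 0 = (0 : ℝ)} = 0 := volume_setOf_last_eq_zero (n := 0) 0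
  have h1 : volume {z : Fin 1 → ℝ | z 0 = (1 : ℝ)} = 0 := volume_setOf_last_eq_zero (n := 0) 1
  refine measure_mono_null (fun x hx => ?_) (measure_union_null h0 h1)
  simp only [Set.mem_sdiff, soloInformedUnitI, mem_setOf_eq, soloInformed_mem_Ioo1, mem_Ioo,
    Rat.cast_zero, Rat.cast_one, not_and, not_lt] at hx
  simp only [mem_union, mem_setOf_eq]
  rcases hx.1.1.eq_or_lt with h | h
  · exact Or.inl h.symm
  · exact Or.inr (le_antisymm hx.1.2 (hx.2 h))

/-- **`κ̃` of a good piece is `(⟦[(u, v), g]⟧, 0)`.** -/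
theorem kappaTilde_eq (hI : soloInformedIoo1 (P.u : ℝ) P.v ⊆ P.ρ.domain) :
    soloInformedKappaTilde P.symbol P.nash =
      SoloInformedV.mk (toFormalPeriod (of (P.piece hI))) 0 := by
  have hvu : (P.v - P.u : ℚ) ≠ 0 := sub_ne_zero.2 P.lt.ne'
  have hc : (0 : ℝ) < ((P.v - P.u : ℚ) : ℝ) := by
    have := P.lt_real; push_cast; linarith
  refine SoloInformedV.ext ?_ ?_
  · rw [soloInformedKappaTilde_fst, SoloInformedV.fst_mk, toFormalPeriod_eq_iff]
    set R₀ := soloInformedPathRepRe P.symbol P.nash with hR₀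
    have hEr : soloInformedIoo1 ((0 : ℚ) : ℝ) ((1 : ℚ) : ℝ) ⊆ R₀.domain := by
      intro x hx
      rw [hR₀, soloInformedPathRepRe_domain]
      simp only [soloInformed_mem_Ioo1, mem_Ioo, Rat.cast_zero, Rat.cast_one] at hx
      exact ⟨hx.1.le, hx.2.le⟩
    set R₁ := R₀.restrict _ (isSemialgebraic_soloInformedIoo1 0 1) hEr with hR₁
    have e₀ : of R₀ - of R₁ ∈ relations :=
      R₀.of_sub_of_restrict_mem_relations _ hEr (by
        rw [hR₀, soloInformedPathRepRe_domain]; exact volume_unitI_diff)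
    obtain ⟨R₂, hR₂d, hR₂i, e₂⟩ := exists_translate (P.piece hI) (fun _ => -P.u)
    have e₁ : of R₁ - of R₂ ∈ relations := by
      refine ratCast_smul_sub_mem_relations hvu R₁ R₂ ?_ fun x hx => ?_
      · rw [hR₂d, hR₁, IntegralRep.domain_restrict]
        ext x
        simp only [mem_preimage, piece, IntegralRep.domain_restrict, soloInformed_mem_Ioo1, mem_Ioo,
          Pi.sub_apply, Rat.cast_neg, sub_neg_eq_add, mem_image, Rat.cast_zero, Rat.cast_one]
        constructor
        · rintro ⟨h1, h2⟩
          refine ⟨(((P.v - P.u : ℚ) : ℝ))⁻¹ • x, ⟨?_, ?_⟩, ?_⟩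
          · simp only [Pi.smul_apply, smul_eq_mul]
            exact mul_pos (inv_pos.2 hc) (by linarith)
          · simp only [Pi.smul_apply, smul_eq_mul]
            rw [inv_mul_lt_iff₀ hc]
            push_cast at h2 ⊢; linarith
          · rw [smul_inv_smul₀ hc.ne']
        · rintro ⟨y, ⟨h1, h2⟩, rfl⟩
          simp only [Pi.smul_apply, smul_eq_mul]
          push_cast
          have := P.lt_real
          constructor <;> nlinarith
      · rw [hR₁, IntegralRep.domain_restrict] at hx
        rw [hR₁, IntegralRep.integrand_restrict, hR₀, soloInformedPathRepRe_integrand, hR₂i]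
        show (soloInformedPathIntegrand P.symbol (x 0)).re = _
        rw [P.pathIntegrand_eq, Complex.ofReal_re, pow_one, abs_of_pos hc]
        show _ = (P.piece hI).integrand _ * _
        rw [piece, IntegralRep.integrand_restrict, soloInformed_integrand_eq_arcFun]
        show _ = P.g _ * _
        simp only [Pi.sub_apply, Pi.smul_apply, smul_eq_mul, Rat.cast_neg, sub_neg_eq_add, φ]
        push_cast
        ring_nf
    have e₂' : of (P.piece hI) - of R₂ ∈ relations := changeOfVariablesRel_subset_relations e₂
    have : of R₀ - of (P.piece hI) =
        (of R₀ - of R₁) + (of R₁ - of R₂) - (of (P.piece hI) - of R₂) := by abel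
    rw [this]
    exact sub_mem (add_mem e₀ e₁) e₂'
  · rw [soloInformedKappaTilde_snd, SoloInformedV.snd_mk]
    refine toFormalPeriod_eq_zero_of_mem (of_mem_relations_of_eqOn_zero _ fun x _ => ?_)
    rw [soloInformedPathRepIm_integrand]
    show (soloInformedPathIntegrand P.symbol (x 0)).im = 0
    rw [P.pathIntegrand_eq, Complex.ofReal_im]

end SoloInformedGoodPiece
end Summit.KontsevichZagierPeriods.KontsevichZagierPeriods.Theorems
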